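import Summits.CriticalPhenomena.PercolationContinuityZ3.Theorems.PercNearOneGluingNoHeavyLowerTailKnQuestion8CoefficientwiseRemSPParallelMap
import Summits.CriticalPhenomena.PercolationContinuityZ3.Theorems.PercNearOneGluingNoHeavyLowerTailKnQuestion8CoefficientwiseRemSPGlue
import Summits.CriticalPhenomena.PercolationContinuityZ3.Theorems.PercNearOneGluingNoHeavyLowerTailKnQuestion8CoefficientwiseTrivialCoreFlip
import HarnessLib

/-!
# THEOREM U3-CLOSURE, parallel step for the rows `R0`, `R1`: pieces glued at both terminals — prim-lf-2 gen 69

Support file (`--supports stmt-CriticalPhenomena-4575`, closed), prover `prim-lf-2` (gen 69).  No definitions, no named facts, no sorries; standard axioms.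
Memo `prim-lf-2/CW-SP-gen69.md` §4.2 (PARALLEL, ρR0/ρR1) with the definitions of `…CoefficientwiseRemSPPieces.lean`; companion of `…CoefficientwiseRemSPParallelN.lean` (ρN); the single-piece component map is `exists_parallel_componentMap` (…RemSPParallelMap.lean).

Setting: disjoint edge sets `D₁`, `D₂` whose edges share only the terminals `x ≠ h`, `D = D₁ ∪ D₂`, target set `W`.  A colouring `t = t₁ ⊔ t₂` of `D` in a red-through
class (`h ∈ C_x t`, `h ∉ C_x(D∖t)`) has every component 'OK' (`h ∉ C_x(Dᵢ∖tᵢ)`, no target in `(C_x tᵢ ∪ C_h tᵢ) ∩ C_x(Dᵢ∖tᵢ)`), at least one component RED (`h ∈ C_x tᵢ`), and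
the composite flag (`some target ≠ h in C_x t ∩ C_h(D∖t)`) is the disjunction of the component flags; `C_x t` is the union of all four component clusters (through case,
`mem_openCluster_union_parallel_through`) and `C_x(D∖t)`, `C_h(D∖t)` are plain unions.  The row map is COMPONENTWISE: a RED component in `R1`/`R0` is moved by the
piece's `R1`/`R0` row, a non-red component with a target in `C_x ∩ C_h(Dᵢ∖tᵢ)` (class `N`) by the `N` row, any other non-red component is complemented.
* `Coefficientwise.hasDomRow_pieceR_parallel` — **rows for `R0`, `R1`, `N` on both pieces ⇒ rows for `R0` and `R1` on the parallel composition**.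
[cite: KozmaNitzan2024, Questions 8–9 (§5.5 p. 36) (context: the Question-8 pocket covariance programme)]
-/

namespace Summit.CriticalPhenomena.PercolationContinuityZ3.Theorems

open Finset Literature.Probability.Percolation

namespace Coefficientwise

variable {ι V : Type*} [DecidableEq ι] (ends : ι → Sym2 V)

open Classical in
/-- **Parallel composition preserves the `R0`/`R1` rows.**  Let `D₁`, `D₂` be disjoint edge sets whose edges share only the vertices `x ≠ h`.  If the classes `pieceR0`,
`pieceR1`, `pieceN` have (strong) rows on `(D₁;x,h)` and on `(D₂;x,h)` for the target set `W`, then `pieceR0` and `pieceR1` have rows on `(D₁ ∪ D₂; x, h)`.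
[cite: KozmaNitzan2024, Questions 8–9 (§5.5 p. 36) (context)] -/
theorem hasDomRow_pieceR_parallel {D₁ D₂ : Finset ι} (hdisj : Disjoint D₁ D₂) {x h : V} (hxh : x ≠ h)
    (hsep : ∀ e ∈ D₁, ∀ e' ∈ D₂, ∀ w : V, w ∈ ends e → w ∈ ends e' → w = x ∨ w = h) (W : Set V)
    (hA₁ : HasDomRow ends D₁ x (pieceR0 ends D₁ x h W)) (hB₁ : HasDomRow ends D₁ x (pieceR1 ends D₁ x h W)) (hC₁ : HasDomRow ends D₁ x (pieceN ends D₁ x h W))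
    (hA₂ : HasDomRow ends D₂ x (pieceR0 ends D₂ x h W)) (hB₂ : HasDomRow ends D₂ x (pieceR1 ends D₂ x h W)) (hC₂ : HasDomRow ends D₂ x (pieceN ends D₂ x h W)) :
    HasDomRow ends (D₁ ∪ D₂) x (pieceR0 ends (D₁ ∪ D₂) x h W) ∧ HasDomRow ends (D₁ ∪ D₂) x (pieceR1 ends (D₁ ∪ D₂) x h W) := by
  set D : Finset ι := D₁ ∪ D₂ with hD
  set Cx : Finset ι → Set V := fun s => openCluster (ends '' (↑s : Set ι)) x with hCx
  set Ch : Finset ι → Set V := fun s => openCluster (ends '' (↑s : Set ι)) h with hCh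
  -- intrinsic component predicates
  set OK : Finset ι → Finset ι → Prop := fun E s => h ∉ Cx (E \ s) ∧ ∀ w ∈ W, ¬ ((w ∈ Cx s ∨ w ∈ Ch s) ∧ w ∈ Cx (E \ s)) with hOK
  set RED : Finset ι → Prop := fun s => h ∈ Cx s with hRED
  set FL : Finset ι → Finset ι → Prop := fun E s => ∃ w ∈ W, w ≠ h ∧ (w ∈ Cx s ∨ w ∈ Ch s) ∧ w ∈ Ch (E \ s) with hFL
  set XH : Finset ι → Finset ι → Prop := fun E s => ∃ w ∈ W, w ∈ Cx s ∧ w ∈ Ch (E \ s) with hXH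
  -- 0. generic facts
  have hsep' : ∀ s₁, s₁ ⊆ D₁ → ∀ s₂, s₂ ⊆ D₂ → ∀ e ∈ s₁, ∀ e' ∈ s₂, ∀ w : V, w ∈ ends e → w ∈ ends e' → w = x ∨ w = h :=
    fun s₁ hs₁ s₂ hs₂ e he e' he' w hw hw' => hsep e (hs₁ he) e' (hs₂ he') w hw hw'
  have hsepH : ∀ s₁, s₁ ⊆ D₁ → ∀ s₂, s₂ ⊆ D₂ → ∀ e ∈ s₁, ∀ e' ∈ s₂, ∀ w : V, w ∈ ends e → w ∈ ends e' → w = h ∨ w = x :=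
    fun s₁ hs₁ s₂ hs₂ e he e' he' w hw hw' => (hsep' s₁ hs₁ s₂ hs₂ e he e' he' w hw hw').symm
  have splitX : ∀ s₁, s₁ ⊆ D₁ → ∀ s₂, s₂ ⊆ D₂ → h ∉ Cx s₁ → h ∉ Cx s₂ → ∀ y, (y ∈ Cx (s₁ ∪ s₂) ↔ y ∈ Cx s₁ ∨ y ∈ Cx s₂) :=
    fun s₁ hs₁ s₂ hs₂ hh1 hh2 y => mem_openCluster_union_parallel ends (hsep' s₁ hs₁ s₂ hs₂) hh1 hh2 y
  have splitH : ∀ s₁, s₁ ⊆ D₁ → ∀ s₂, s₂ ⊆ D₂ → h ∉ Cx s₁ → h ∉ Cx s₂ → ∀ y, (y ∈ Ch (s₁ ∪ s₂) ↔ y ∈ Ch s₁ ∨ y ∈ Ch s₂) := by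
    intro s₁ hs₁ s₂ hs₂ hh1 hh2 y
    have hx1 : x ∉ Ch s₁ := fun hx => hh1 ((mem_openCluster_comm ends s₁ h x).mp hx)
    have hx2 : x ∉ Ch s₂ := fun hx => hh2 ((mem_openCluster_comm ends s₂ h x).mp hx)
    exact mem_openCluster_union_parallel ends (hsepH s₁ hs₁ s₂ hs₂) hx1 hx2 y
  have through : ∀ s₁, s₁ ⊆ D₁ → ∀ s₂, s₂ ⊆ D₂ → (h ∈ Cx s₁ ∨ h ∈ Cx s₂) → ∀ y,
      (y ∈ Cx (s₁ ∪ s₂) ↔ y ∈ Cx s₁ ∨ y ∈ Cx s₂ ∨ y ∈ Ch s₁ ∨ y ∈ Ch s₂) :=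
    fun s₁ hs₁ s₂ hs₂ hz y => mem_openCluster_union_parallel_through ends (hsep' s₁ hs₁ s₂ hs₂) hz y
  have hred_split : ∀ s₁, s₁ ⊆ D₁ → ∀ s₂, s₂ ⊆ D₂ → h ∈ Cx (s₁ ∪ s₂) → (h ∈ Cx s₁ ∨ h ∈ Cx s₂) := by
    intro s₁ hs₁ s₂ hs₂ hh
    rcases mem_openCluster_union_parallel_subset ends (hsep' s₁ hs₁ s₂ hs₂) hh with h1 | h2 | ⟨h3, _⟩
    · exact Or.inl h1
    · exact Or.inr h2
    · exact h3
  have hdecomp : ∀ t, t ⊆ D → t = (t ∩ D₁) ∪ (t ∩ D₂) := by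
    intro t ht; ext i
    simp only [Finset.mem_union, Finset.mem_inter]
    constructor
    · intro hi; rcases Finset.mem_union.mp (ht hi) with h1 | h2
      · exact Or.inl ⟨hi, h1⟩
      · exact Or.inr ⟨hi, h2⟩
    · rintro (⟨hi, _⟩ | ⟨hi, _⟩) <;> exact hi
  have hsdiff : ∀ s₁, s₁ ⊆ D₁ → ∀ s₂, s₂ ⊆ D₂ → D \ (s₁ ∪ s₂) = (D₁ \ s₁) ∪ (D₂ \ s₂) :=
    fun s₁ hs₁ s₂ hs₂ => union_sdiff_union_of_subset hdisj hs₁ hs₂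
  have hinter₁ : ∀ s₁, s₁ ⊆ D₁ → ∀ s₂, s₂ ⊆ D₂ → (s₁ ∪ s₂) ∩ D₁ = s₁ := by
    intro s₁ hs₁ s₂ hs₂; ext i
    simp only [Finset.mem_inter, Finset.mem_union]
    constructor
    · rintro ⟨h12 | h12, hi1⟩
      · exact h12
      · exact absurd (Finset.mem_inter.mpr ⟨hi1, hs₂ h12⟩) (Finset.disjoint_iff_inter_eq_empty.mp hdisj ▸ Finset.notMem_empty i)
    · intro hi; exact ⟨Or.inl hi, hs₁ hi⟩
  have hinter₂ : ∀ s₁, s₁ ⊆ D₁ → ∀ s₂, s₂ ⊆ D₂ → (s₁ ∪ s₂) ∩ D₂ = s₂ := by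
    intro s₁ hs₁ s₂ hs₂; ext i
    simp only [Finset.mem_inter, Finset.mem_union]
    constructor
    · rintro ⟨h12 | h12, hi2⟩
      · exact absurd (Finset.mem_inter.mpr ⟨hs₁ h12, hi2⟩) (Finset.disjoint_iff_inter_eq_empty.mp hdisj ▸ Finset.notMem_empty i)
      · exact h12
    · intro hi; exact ⟨Or.inr hi, hs₂ hi⟩
  have cross : ∀ s₁, s₁ ⊆ D₁ → ∀ s₂, s₂ ⊆ D₂ → ∀ (a b w : V), w ∈ openCluster (ends '' (↑s₁ : Set ι)) a →
      w ∈ openCluster (ends '' (↑s₂ : Set ι)) b → w = a ∨ w = b ∨ w = x ∨ w = h := by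
    intro s₁ hs₁ s₂ hs₂ a b w hwa hwb
    by_cases hwa' : w = a
    · exact Or.inl hwa'
    by_cases hwb' : w = b
    · exact Or.inr (Or.inl hwb')
    obtain ⟨e, he, hwe⟩ := exists_edge_of_mem_openCluster ends hwa hwa'
    obtain ⟨e', he', hwe'⟩ := exists_edge_of_mem_openCluster ends hwb hwb'
    exact Or.inr (Or.inr (hsep' s₁ hs₁ s₂ hs₂ e he e' he' w hwe hwe'))
  have hxW_of_OK : ∀ E s, OK E s → x ∉ W := fun E s hO hxW => hO.2 x hxW ⟨Or.inl (mem_openCluster_self _ x), mem_openCluster_self _ x⟩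
  -- 1. CHARACTERISATION of the composite red-through classes
  --    core(t) := h ∈ Cx t ∧ h ∉ Cx (D \ t) ∧ no x-core;  then  pieceR0 D = core ∧ ¬F,  pieceR1 D = core ∧ F  with F the composite flag.
  have char_fwd : ∀ t, t ⊆ D → (h ∈ Cx t ∧ h ∉ Cx (D \ t) ∧ (∀ w ∈ W, ¬ (w ∈ Cx t ∧ w ∈ Cx (D \ t)))) →
      (OK D₁ (t ∩ D₁) ∧ OK D₂ (t ∩ D₂) ∧ (RED (t ∩ D₁) ∨ RED (t ∩ D₂)) ∧
        ((∃ w ∈ W, w ≠ h ∧ w ∈ Cx t ∧ w ∈ Ch (D \ t)) ↔ (FL D₁ (t ∩ D₁) ∨ FL D₂ (t ∩ D₂)))) := by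
    intro t ht ⟨hhK, hhB, hxx⟩
    set t₁ := t ∩ D₁ with ht₁
    set t₂ := t ∩ D₂ with ht₂
    have ht₁D : t₁ ⊆ D₁ := Finset.inter_subset_right
    have ht₂D : t₂ ⊆ D₂ := Finset.inter_subset_right
    have htt : t = t₁ ∪ t₂ := hdecomp t ht
    rw [htt] at hhK hhB hxx
    rw [hsdiff t₁ ht₁D t₂ ht₂D] at hhB hxx
    have hB1 : h ∉ Cx (D₁ \ t₁) := fun hh => hhB (openCluster_image_mono ends Finset.subset_union_left x hh)
    have hB2 : h ∉ Cx (D₂ \ t₂) := fun hh => hhB (openCluster_image_mono ends Finset.subset_union_right x hh)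
    have hred := hred_split t₁ ht₁D t₂ ht₂D hhK
    have sK := through t₁ ht₁D t₂ ht₂D hred
    have sB := splitX (D₁ \ t₁) Finset.sdiff_subset (D₂ \ t₂) Finset.sdiff_subset hB1 hB2
    have sP' := splitH (D₁ \ t₁) Finset.sdiff_subset (D₂ \ t₂) Finset.sdiff_subset hB1 hB2
    have OK1 : OK D₁ t₁ := by
      refine ⟨hB1, fun w hw hh => hxx w hw ⟨(sK w).mpr ?_, (sB w).mpr (Or.inl hh.2)⟩⟩
      rcases hh.1 with h1 | h1
      · exact Or.inl h1
      · exact Or.inr (Or.inr (Or.inl h1))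
    have OK2 : OK D₂ t₂ := by
      refine ⟨hB2, fun w hw hh => hxx w hw ⟨(sK w).mpr ?_, (sB w).mpr (Or.inr hh.2)⟩⟩
      rcases hh.1 with h1 | h1
      · exact Or.inr (Or.inl h1)
      · exact Or.inr (Or.inr (Or.inr h1))
    have hxW : x ∉ W := hxW_of_OK D₁ t₁ OK1
    refine ⟨OK1, OK2, hred, ?_⟩
    rw [htt, hsdiff t₁ ht₁D t₂ ht₂D]
    constructor
    · rintro ⟨w, hw, hwh, hwK, hwP⟩
      -- w lies in one of the four red clusters and in one of the two blue h-clusters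
      rcases (sP' w).mp hwP with p1 | p2
      · rcases (sK w).mp hwK with k | k | k | k
        · exact Or.inl ⟨w, hw, hwh, Or.inl k, p1⟩
        · rcases cross (D₁ \ t₁) Finset.sdiff_subset t₂ ht₂D h x w p1 k with rfl | rfl | rfl | rfl
          · exact absurd rfl hwh
          · exact absurd hw hxW
          · exact absurd hw hxW
          · exact absurd rfl hwh
        · exact Or.inl ⟨w, hw, hwh, Or.inr k, p1⟩
        · rcases cross (D₁ \ t₁) Finset.sdiff_subset t₂ ht₂D h h w p1 k with rfl | rfl | rfl | rfl
          · exact absurd rfl hwh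
          · exact absurd rfl hwh
          · exact absurd hw hxW
          · exact absurd rfl hwh
      · rcases (sK w).mp hwK with k | k | k | k
        · rcases cross t₁ ht₁D (D₂ \ t₂) Finset.sdiff_subset x h w k p2 with rfl | rfl | rfl | rfl
          · exact absurd hw hxW
          · exact absurd rfl hwh
          · exact absurd hw hxW
          · exact absurd rfl hwh
        · exact Or.inr ⟨w, hw, hwh, Or.inl k, p2⟩
        · rcases cross t₁ ht₁D (D₂ \ t₂) Finset.sdiff_subset h h w k p2 with rfl | rfl | rfl | rfl
          · exact absurd rfl hwh
          · exact absurd rfl hwh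
          · exact absurd hw hxW
          · exact absurd rfl hwh
        · exact Or.inr ⟨w, hw, hwh, Or.inr k, p2⟩
    · rintro (⟨w, hw, hwh, hwK, hwP⟩ | ⟨w, hw, hwh, hwK, hwP⟩)
      · refine ⟨w, hw, hwh, (sK w).mpr ?_, (sP' w).mpr (Or.inl hwP)⟩
        rcases hwK with k | k
        · exact Or.inl k
        · exact Or.inr (Or.inr (Or.inl k))
      · refine ⟨w, hw, hwh, (sK w).mpr ?_, (sP' w).mpr (Or.inr hwP)⟩
        rcases hwK with k | k
        · exact Or.inr (Or.inl k)
        · exact Or.inr (Or.inr (Or.inr k))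
  have char_bwd : ∀ s₁, s₁ ⊆ D₁ → ∀ s₂, s₂ ⊆ D₂ → OK D₁ s₁ → OK D₂ s₂ → (RED s₁ ∨ RED s₂) →
      (h ∈ Cx (s₁ ∪ s₂) ∧ h ∉ Cx (D \ (s₁ ∪ s₂)) ∧ (∀ w ∈ W, ¬ (w ∈ Cx (s₁ ∪ s₂) ∧ w ∈ Cx (D \ (s₁ ∪ s₂))))) := by
    intro s₁ hs₁ s₂ hs₂ hO1 hO2 hred
    obtain ⟨hB1, hnx1⟩ := hO1
    obtain ⟨hB2, hnx2⟩ := hO2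
    have hxW : x ∉ W := hxW_of_OK D₁ s₁ ⟨hB1, hnx1⟩
    have sK := through s₁ hs₁ s₂ hs₂ hred
    have sB := splitX (D₁ \ s₁) Finset.sdiff_subset (D₂ \ s₂) Finset.sdiff_subset hB1 hB2
    refine ⟨?_, ?_, ?_⟩
    · rcases hred with h1 | h2
      · exact openCluster_image_mono ends Finset.subset_union_left x h1
      · exact openCluster_image_mono ends Finset.subset_union_right x h2
    · rw [hsdiff s₁ hs₁ s₂ hs₂]; intro hh
      rcases (sB h).mp hh with h1 | h2
      · exact hB1 h1
      · exact hB2 h2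
    · intro w hw hh
      rw [hsdiff s₁ hs₁ s₂ hs₂] at hh
      obtain ⟨hwK, hwB⟩ := hh
      rcases (sB w).mp hwB with b1 | b2
      · rcases (sK w).mp hwK with k | k | k | k
        · exact hnx1 w hw ⟨Or.inl k, b1⟩
        · rcases cross (D₁ \ s₁) Finset.sdiff_subset s₂ hs₂ x x w b1 k with rfl | rfl | rfl | rfl
          · exact hxW hw
          · exact hxW hw
          · exact hxW hw
          · exact hB1 b1
        · exact hnx1 w hw ⟨Or.inr k, b1⟩
        · rcases cross (D₁ \ s₁) Finset.sdiff_subset s₂ hs₂ x h w b1 k with rfl | rfl | rfl | rfl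
          · exact hxW hw
          · exact hB1 b1
          · exact hxW hw
          · exact hB1 b1
      · rcases (sK w).mp hwK with k | k | k | k
        · rcases cross s₁ hs₁ (D₂ \ s₂) Finset.sdiff_subset x x w k b2 with rfl | rfl | rfl | rfl
          · exact hxW hw
          · exact hxW hw
          · exact hxW hw
          · exact hB2 b2
        · exact hnx2 w hw ⟨Or.inl k, b2⟩
        · rcases cross s₁ hs₁ (D₂ \ s₂) Finset.sdiff_subset h x w k b2 with rfl | rfl | rfl | rfl
          · exact hB2 b2
          · exact hxW hw
          · exact hxW hw
          · exact hB2 b2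
        · exact hnx2 w hw ⟨Or.inr k, b2⟩
  -- the composite flag for s₁ ∪ s₂ in terms of the components (from char_fwd applied to s₁ ∪ s₂)
  -- 2. the component maps (…RemSPParallelMap)
  obtain ⟨f₁, f₁_props, f₁_inj⟩ := exists_parallel_componentMap ends D₁ x h W hA₁ hB₁ hC₁
  obtain ⟨f₂, f₂_props, f₂_inj⟩ := exists_parallel_componentMap ends D₂ x h W hA₂ hB₂ hC₂
  -- 4. the composite map and its properties on the 'core' class
  set Pm : Finset ι → Finset ι := fun t => f₁ (t ∩ D₁) ∪ f₂ (t ∩ D₂) with hPm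
  have core_of_R0 : ∀ t, pieceR0 ends D x h W t → (h ∈ Cx t ∧ h ∉ Cx (D \ t) ∧ (∀ w ∈ W, ¬ (w ∈ Cx t ∧ w ∈ Cx (D \ t)))) :=
    fun t hP => ⟨hP.1, hP.2.1, hP.2.2.1⟩
  have core_of_R1 : ∀ t, pieceR1 ends D x h W t → (h ∈ Cx t ∧ h ∉ Cx (D \ t) ∧ (∀ w ∈ W, ¬ (w ∈ Cx t ∧ w ∈ Cx (D \ t)))) :=
    fun t hP => ⟨hP.1, hP.2.1, hP.2.2.1⟩
  -- image analysis: for t in the core class, Pm t is in the core class with the same flag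
  have main : ∀ t, t ⊆ D → (h ∈ Cx t ∧ h ∉ Cx (D \ t) ∧ (∀ w ∈ W, ¬ (w ∈ Cx t ∧ w ∈ Cx (D \ t)))) →
      (Pm t ⊆ D ∧ (h ∈ Cx (Pm t) ∧ h ∉ Cx (D \ Pm t) ∧ (∀ w ∈ W, ¬ (w ∈ Cx (Pm t) ∧ w ∈ Cx (D \ Pm t)))) ∧
        ((∃ w ∈ W, w ≠ h ∧ w ∈ Cx (Pm t) ∧ w ∈ Ch (D \ Pm t)) ↔ (∃ w ∈ W, w ≠ h ∧ w ∈ Cx t ∧ w ∈ Ch (D \ t))) ∧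
        Cx (D \ t) ⊆ Cx (Pm t)) := by
    intro t ht hcore
    obtain ⟨OK1, OK2, hred, hflag⟩ := char_fwd t ht hcore
    obtain ⟨hs1, hO1, hr1, hF1, hd1⟩ := f₁_props (t ∩ D₁) Finset.inter_subset_right OK1
    obtain ⟨hs2, hO2, hr2, hF2, hd2⟩ := f₂_props (t ∩ D₂) Finset.inter_subset_right OK2
    have hred' : RED (f₁ (t ∩ D₁)) ∨ RED (f₂ (t ∩ D₂)) := hred.imp hr1.mpr hr2.mpr
    have hcore' := char_bwd _ hs1 _ hs2 hO1 hO2 hred'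
    refine ⟨Finset.union_subset_union hs1 hs2, hcore', ?_, ?_⟩
    · -- flags: both sides reduce to the component flags
      have hflag' := (char_fwd _ (Finset.union_subset_union hs1 hs2) hcore').2.2.2
      rw [hinter₁ _ hs1 _ hs2, hinter₂ _ hs1 _ hs2] at hflag'
      rw [hflag', hflag]; exact or_congr hF1 hF2
    · -- domination
      intro y hy
      rw [hdecomp t ht, hsdiff _ Finset.inter_subset_right _ Finset.inter_subset_right] at hy
      have sB := splitX (D₁ \ (t ∩ D₁)) Finset.sdiff_subset (D₂ \ (t ∩ D₂)) Finset.sdiff_subset OK1.1 OK2.1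
      rcases (sB y).mp hy with hy1 | hy2
      · exact openCluster_image_mono ends Finset.subset_union_left x (hd1 hy1)
      · exact openCluster_image_mono ends Finset.subset_union_right x (hd2 hy2)
  have inj : ∀ t t', t ⊆ D → (h ∈ Cx t ∧ h ∉ Cx (D \ t) ∧ (∀ w ∈ W, ¬ (w ∈ Cx t ∧ w ∈ Cx (D \ t)))) →
      t' ⊆ D → (h ∈ Cx t' ∧ h ∉ Cx (D \ t') ∧ (∀ w ∈ W, ¬ (w ∈ Cx t' ∧ w ∈ Cx (D \ t')))) → Pm t = Pm t' → t = t' := by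
    intro t t' ht hc ht' hc' heq
    obtain ⟨OK1, OK2, -, -⟩ := char_fwd t ht hc
    obtain ⟨OK1', OK2', -, -⟩ := char_fwd t' ht' hc'
    have hs1 := (f₁_props (t ∩ D₁) Finset.inter_subset_right OK1).1
    have hs2 := (f₂_props (t ∩ D₂) Finset.inter_subset_right OK2).1
    have hs1' := (f₁_props (t' ∩ D₁) Finset.inter_subset_right OK1').1
    have hs2' := (f₂_props (t' ∩ D₂) Finset.inter_subset_right OK2').1
    have e1 : f₁ (t ∩ D₁) = f₁ (t' ∩ D₁) := by
      have := congrArg (fun s => s ∩ D₁) heq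
      simp only [hPm] at this
      rwa [hinter₁ _ hs1 _ hs2, hinter₁ _ hs1' _ hs2'] at this
    have e2 : f₂ (t ∩ D₂) = f₂ (t' ∩ D₂) := by
      have := congrArg (fun s => s ∩ D₂) heq
      simp only [hPm] at this
      rwa [hinter₂ _ hs1 _ hs2, hinter₂ _ hs1' _ hs2'] at this
    have q1 := f₁_inj _ _ Finset.inter_subset_right OK1 Finset.inter_subset_right OK1' e1
    have q2 := f₂_inj _ _ Finset.inter_subset_right OK2 Finset.inter_subset_right OK2' e2
    rw [hdecomp t ht, hdecomp t' ht', q1, q2]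
  -- 5. the two rows
  constructor
  · refine ⟨Pm, ?_, ?_, ?_⟩
    · intro t ht hP
      obtain ⟨hsub, hcore', hflag', -⟩ := main t ht (core_of_R0 t hP)
      refine ⟨hsub, hcore'.1, hcore'.2.1, hcore'.2.2, ?_⟩
      intro w hw hwh hh
      obtain ⟨w', hw', hwh', h1, h2⟩ := hflag'.mp ⟨w, hw, hwh, hh.1, hh.2⟩
      exact hP.2.2.2 w' hw' hwh' ⟨h1, h2⟩
    · intro t t' ht hP ht' hP' heq
      exact inj t t' ht (core_of_R0 t hP) ht' (core_of_R0 t' hP') heq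
    · intro t ht hP
      exact (main t ht (core_of_R0 t hP)).2.2.2
  · refine ⟨Pm, ?_, ?_, ?_⟩
    · intro t ht hP
      obtain ⟨hsub, hcore', hflag', -⟩ := main t ht (core_of_R1 t hP)
      exact ⟨hsub, hcore'.1, hcore'.2.1, hcore'.2.2, hflag'.mpr hP.2.2.2⟩
    · intro t t' ht hP ht' hP' heq
      exact inj t t' ht (core_of_R1 t hP) ht' (core_of_R1 t' hP') heq
    · intro t ht hP
      exact (main t ht (core_of_R1 t hP)).2.2.2

end Coefficientwise

end Summit.CriticalPhenomena.PercolationContinuityZ3.Theorems
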